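import Mathlib
import Literature.Probability.RandomPlanarGeometry.HexSAW
import Literature.Probability.RandomPlanarGeometry.SLEUniquenessInLaw
import Summits.CriticalPhenomena.SAWScalingLimit.Theses.SAWMassiveIsingTilt
import Summits.CriticalPhenomena.SAWScalingLimit.Theorems.SAWMassiveIsingTiltCornerLaw
import Summits.CriticalPhenomena.SAWScalingLimit.Theorems.SAWMassiveIsingTiltDefs

/-!
# The logical geometry of the crux `CriticalCurveContinuity` (stmt-CriticalPhenomena-7686)

Route `SAWMassiveIsingTilt` of `CriticalPhenomena/SAWScalingLimit`; lead prover of the line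
`registered` (skeleton `Cruxes/CriticalCurveContinuity/Lines/birth.lean`), cycle 1. Objects and
predicates (`tiltLaw`, `TiltSLE`, `SameLimit`) are those of `Theorems/SAWMassiveIsingTiltDefs.lean`.

The line cuts the crux `CriticalCurveContinuity := MassiveWindowSLE → OneClassOnCriticalCurve` into
* stub 1 (`stub_constancyAlongCurve`): a CONSTANCY CURVE through the SAW corner —
  `∃ xc, xc 0 = x_c(Hex) ∧ ∀ y y' ∈ [0, 1/√3), SameLimit (xc y) y (xc y') y'`;
* stub 2 (`stub_windowLandsOnCurve`): for every such curve, `MassiveWindowSLE` gives `TiltSLE` at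
  one fixed `y₀ ∈ (0, 1/√3)` on it.

This file PROVES (sorry-free, standard axioms) that the cut is canonical:

* `SameLimit` is an equivalence relation (`sameLimit_refl/symm/trans`), `TiltSLE` is transported
  along it (`tiltSLE_of_sameLimit`), and two `TiltSLE` points are `SameLimit`
  (`sameLimit_of_tiltSLE` — uniqueness in law of chordal SLE, the tree's PROVED
  `IsSLECurve.map_eq_holds`);
* the SAW corner: `TiltSLE x_c 0 ↔ HexSAWScalingLimit` (`tiltSLE_corner_iff`, through the landed
  `cornerLaw_proof`), and on a constancy curve every point is equivalent to the corner
  (`tiltSLE_on_curve_iff`);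
* `windowLandsOnCurve_iff_corner` — stub 2 is, for every constancy curve, exactly the CORNER
  LANDING `MassiveWindowSLE → HexSAWScalingLimit`;
* `oneClassOnCriticalCurve_iff_constancy_and_hexSAW` — the route TARGET is exactly
  (stub 1 ∧ DCS Conjecture 1 `HexSAWScalingLimit`);
* `criticalCurveContinuity_iff_window_gives_constancy_and_hexSAW` — the CRUX is exactly
  "`MassiveWindowSLE` gives a constancy curve AND DCS Conjecture 1"; hence modulo stub 1 the
  crux is the corner landing (`criticalCurveContinuity_iff_corner_of_constancy`).

* `hexSAW_iff_windowMeetsCorner`, `window_gives_hexSAW_iff_windowMeetsCorner` (wave-1 worker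
  audit) — the residual content READ ON THE LATTICE: under the window's SLE statement, DCS
  Conjecture 1 ⟺ "the window laws and the critical hexagonal SAW laws are asymptotically equal";
  so the corner landing ⟺ "every SLE_{8/3} window meets the corner".

No statement of the line is asserted; `HexSAWScalingLimit` (a registered OPEN conjecture) only
ever appears inside equivalences / as a hypothesis.
-/

noncomputable section

open MeasureTheory Filter Topology Set
open scoped NNReal ENNReal BoundedContinuousFunction
open Literature.Probability Literature.Probability.LatticeModels
  Literature.Probability.RandomPlanarGeometry
open Summit.CriticalPhenomena.SAWScalingLimit.Theses.SAWMassiveIsingTilt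

namespace Summit.CriticalPhenomena.SAWScalingLimit.Theorems.SAWMassiveIsingTilt

/-! ### `SameLimit` is an equivalence relation; `TiltSLE` is constant on its classes -/

/-- `SameLimit` is reflexive. -/
theorem sameLimit_refl : ∀ x y : ℝ, SameLimit x y x y := by
  intro x y D a b hab f
  simp only [sub_self]
  exact tendsto_const_nhds

/-- `SameLimit` is symmetric. -/
theorem sameLimit_symm : ∀ {x y x' y' : ℝ}, SameLimit x y x' y' → SameLimit x' y' x y := by
  intro x y x' y' h D a b hab f
  have := (h D a b hab f).neg
  simp only [neg_sub, neg_zero] at this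
  exact this

/-- `SameLimit` is transitive. -/
theorem sameLimit_trans : ∀ {x y x' y' x'' y'' : ℝ},
    SameLimit x y x' y' → SameLimit x' y' x'' y'' → SameLimit x y x'' y'' := by
  intro x y x' y' x'' y'' h h' D a b hab f
  have := (h D a b hab f).add (h' D a b hab f)
  simp only [sub_add_sub_cancel, add_zero] at this
  exact this

/-- **Propagation**: asymptotically equal laws share the SLE_{8/3} limit (same SLE curve `Γ`,
`Tendsto.add` on bounded continuous test functions; measurability is automatic on the discrete
σ-algebra of lattice walks). -/
theorem tiltSLE_of_sameLimit : ∀ {x y x' y' : ℝ}, SameLimit x y x' y' → TiltSLE x' y' → TiltSLE x y := by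
  intro x y x' y' hS hT D a b hab
  obtain ⟨Γ, hΓ, -, hTL⟩ := hT D a b hab
  refine ⟨Γ, hΓ, Eventually.of_forall fun δ => (SAW.EmbDomainSAW.measurable_of_top _).aemeasurable,
    fun f => ?_⟩
  have h := (hS D a b hab f).add (hTL f)
  simpa only [sub_add_cancel, zero_add] using h

/-- Two parameter points with SLE_{8/3} limits have asymptotically equal laws: the two SLE_{8/3}
random curves handed by `TiltSLE` have the same law (`IsSLECurve.map_eq_holds`, proved). -/
theorem sameLimit_of_tiltSLE : ∀ {x y x' y' : ℝ}, TiltSLE x y → TiltSLE x' y' → SameLimit x y x' y' := by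
  intro x y x' y' h h' D a b hab f
  obtain ⟨Γ, hΓ, -, hT⟩ := h D a b hab
  obtain ⟨Γ', hΓ', -, hT'⟩ := h' D a b hab
  have hlaw : Process.preWienerMeasure.map Γ = Process.preWienerMeasure.map Γ' :=
    IsSLECurve.map_eq_holds hΓ hΓ'
  have hint : ∫ ω, f (Γ ω) ∂Process.preWienerMeasure = ∫ ω, f (Γ' ω) ∂Process.preWienerMeasure := by
    rw [← integral_map hΓ.aemeasurable f.continuous.aestronglyMeasurable,
      ← integral_map hΓ'.aemeasurable f.continuous.aestronglyMeasurable, hlaw]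
  have := (hT f).sub (hT' f)
  rwa [hint, sub_self] at this

/-! ### The SAW corner and constancy curves -/

/-- **The SAW corner.** `TiltSLE x_c 0` is DCS Conjecture 1 `HexSAWScalingLimit` verbatim, through
the landed `CornerLaw` (`tiltLaw Ω δ x_c 0 a b = hexSAWLaw Ω δ a b`). -/
theorem tiltSLE_corner_iff : TiltSLE SAW.hexCriticalFugacity 0 ↔ SAW.HexSAWScalingLimit := by
  unfold TiltSLE SAW.HexSAWScalingLimit
  simp only [tiltLaw_hexCriticalFugacity_zero]

/-- `0 ∈ [0, 1/√3)`. -/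
theorem zero_mem_Ico_yc : (0 : ℝ) ∈ Set.Ico (0 : ℝ) (Real.sqrt 3)⁻¹ :=
  ⟨le_rfl, inv_pos.mpr (Real.sqrt_pos.mpr (by norm_num))⟩

/-- **On a constancy curve every point carries the corner's limit**: along a curve `xc` through
the SAW corner with asymptotically `y`-independent laws, `TiltSLE (xc y) y` at ANY `y ∈ [0, 1/√3)`
is equivalent to DCS Conjecture 1. -/
theorem tiltSLE_on_curve_iff {xc : ℝ → ℝ} (hxc0 : xc 0 = SAW.hexCriticalFugacity)
    (hsame : ∀ y ∈ Set.Ico (0 : ℝ) (Real.sqrt 3)⁻¹, ∀ y' ∈ Set.Ico (0 : ℝ) (Real.sqrt 3)⁻¹,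
      SameLimit (xc y) y (xc y') y')
    {y : ℝ} (hy : y ∈ Set.Ico (0 : ℝ) (Real.sqrt 3)⁻¹) :
    TiltSLE (xc y) y ↔ SAW.HexSAWScalingLimit := by
  rw [← tiltSLE_corner_iff, ← hxc0]
  exact ⟨fun h => tiltSLE_of_sameLimit (hsame 0 zero_mem_Ico_yc y hy) h,
    fun h => tiltSLE_of_sameLimit (hsame y hy 0 zero_mem_Ico_yc) h⟩

/-! ### Stub 2 is the corner landing -/

/-- **Stub 2 ↔ the corner landing, for every constancy curve**: the registered signature of
`stub_windowLandsOnCurve` is equivalent to "for every constancy curve through the SAW corner,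
`MassiveWindowSLE` implies DCS Conjecture 1". -/
theorem windowLandsOnCurve_iff_corner :
    (∀ xc : ℝ → ℝ, xc 0 = SAW.hexCriticalFugacity →
      (∀ y ∈ Set.Ico (0 : ℝ) (Real.sqrt 3)⁻¹, ∀ y' ∈ Set.Ico (0 : ℝ) (Real.sqrt 3)⁻¹,
        SameLimit (xc y) y (xc y') y') →
      MassiveWindowSLE → ∃ y₀ ∈ Set.Ioo (0 : ℝ) (Real.sqrt 3)⁻¹, TiltSLE (xc y₀) y₀) ↔
    ∀ xc : ℝ → ℝ, xc 0 = SAW.hexCriticalFugacity →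
      (∀ y ∈ Set.Ico (0 : ℝ) (Real.sqrt 3)⁻¹, ∀ y' ∈ Set.Ico (0 : ℝ) (Real.sqrt 3)⁻¹,
        SameLimit (xc y) y (xc y') y') →
      MassiveWindowSLE → SAW.HexSAWScalingLimit := by
  have hyc : (0 : ℝ) < (Real.sqrt 3)⁻¹ := inv_pos.mpr (Real.sqrt_pos.mpr (by norm_num))
  refine forall_congr' fun xc => forall_congr' fun hxc0 => forall_congr' fun hsame =>
    forall_congr' fun _ => ?_
  constructor
  · rintro ⟨y₀, hy₀, hT⟩
    exact (tiltSLE_on_curve_iff hxc0 hsame (Set.Ioo_subset_Ico_self hy₀)).1 hT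
  · intro hHex
    refine ⟨(Real.sqrt 3)⁻¹ / 2, ⟨by positivity, by linarith⟩, ?_⟩
    exact (tiltSLE_on_curve_iff hxc0 hsame ⟨by positivity, by linarith⟩).2 hHex

/-! ### The target and the crux, exactly -/

/-- Stub 1 and DCS Conjecture 1 give the route TARGET `OneClassOnCriticalCurve` (in this direction
the massive window is not used at all). -/
theorem oneClassOnCriticalCurve_of_constancy_of_hexSAW
    (h1 : ∃ xc : ℝ → ℝ, xc 0 = SAW.hexCriticalFugacity ∧
      ∀ y ∈ Set.Ico (0 : ℝ) (Real.sqrt 3)⁻¹, ∀ y' ∈ Set.Ico (0 : ℝ) (Real.sqrt 3)⁻¹,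
        SameLimit (xc y) y (xc y') y')
    (hHex : SAW.HexSAWScalingLimit) : OneClassOnCriticalCurve := by
  obtain ⟨xc, hxc0, hsame⟩ := h1
  exact oneClassOnCriticalCurve_iff.2
    ⟨xc, hxc0, fun y hy => (tiltSLE_on_curve_iff hxc0 hsame hy).2 hHex⟩

/-- The route target forces stub 1: its critical curve IS a constancy curve (uniqueness in law of
chordal SLE_{8/3}). -/
theorem constancy_of_oneClassOnCriticalCurve (h : OneClassOnCriticalCurve) :
    ∃ xc : ℝ → ℝ, xc 0 = SAW.hexCriticalFugacity ∧
      ∀ y ∈ Set.Ico (0 : ℝ) (Real.sqrt 3)⁻¹, ∀ y' ∈ Set.Ico (0 : ℝ) (Real.sqrt 3)⁻¹,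
        SameLimit (xc y) y (xc y') y' := by
  obtain ⟨xc, hxc0, hall⟩ := oneClassOnCriticalCurve_iff.1 h
  exact ⟨xc, hxc0, fun y hy y' hy' => sameLimit_of_tiltSLE (hall y hy) (hall y' hy')⟩

/-- The route target contains DCS Conjecture 1 (its `y = 0` instance, through `CornerLaw`). -/
theorem hexSAW_of_oneClassOnCriticalCurve (h : OneClassOnCriticalCurve) : SAW.HexSAWScalingLimit := by
  obtain ⟨xc, hxc0, hall⟩ := oneClassOnCriticalCurve_iff.1 h
  have hT : TiltSLE (xc 0) 0 := hall 0 zero_mem_Ico_yc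
  rw [hxc0] at hT
  exact tiltSLE_corner_iff.1 hT

/-- **THE GEOMETRY OF THE TARGET.** `OneClassOnCriticalCurve` is EXACTLY the conjunction of a
constancy curve through the SAW corner (stub 1) and DCS Conjecture 1. -/
theorem oneClassOnCriticalCurve_iff_constancy_and_hexSAW :
    OneClassOnCriticalCurve ↔
      (∃ xc : ℝ → ℝ, xc 0 = SAW.hexCriticalFugacity ∧
        ∀ y ∈ Set.Ico (0 : ℝ) (Real.sqrt 3)⁻¹, ∀ y' ∈ Set.Ico (0 : ℝ) (Real.sqrt 3)⁻¹,
          SameLimit (xc y) y (xc y') y') ∧ SAW.HexSAWScalingLimit :=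
  ⟨fun h => ⟨constancy_of_oneClassOnCriticalCurve h, hexSAW_of_oneClassOnCriticalCurve h⟩,
    fun h => oneClassOnCriticalCurve_of_constancy_of_hexSAW h.1 h.2⟩

/-- **THE GEOMETRY OF THE CRUX.** `CriticalCurveContinuity` is EXACTLY: the massive window yields a
constancy curve through the SAW corner AND DCS Conjecture 1. -/
theorem criticalCurveContinuity_iff_window_gives_constancy_and_hexSAW :
    CriticalCurveContinuity ↔
      (MassiveWindowSLE →
        (∃ xc : ℝ → ℝ, xc 0 = SAW.hexCriticalFugacity ∧
          ∀ y ∈ Set.Ico (0 : ℝ) (Real.sqrt 3)⁻¹, ∀ y' ∈ Set.Ico (0 : ℝ) (Real.sqrt 3)⁻¹,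
            SameLimit (xc y) y (xc y') y') ∧ SAW.HexSAWScalingLimit) := by
  unfold CriticalCurveContinuity
  exact forall_congr' fun _ => oneClassOnCriticalCurve_iff_constancy_and_hexSAW

/-- **Modulo stub 1 the crux is the corner landing.** -/
theorem criticalCurveContinuity_iff_corner_of_constancy
    (h1 : ∃ xc : ℝ → ℝ, xc 0 = SAW.hexCriticalFugacity ∧
      ∀ y ∈ Set.Ico (0 : ℝ) (Real.sqrt 3)⁻¹, ∀ y' ∈ Set.Ico (0 : ℝ) (Real.sqrt 3)⁻¹,
        SameLimit (xc y) y (xc y') y') :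
    CriticalCurveContinuity ↔ (MassiveWindowSLE → SAW.HexSAWScalingLimit) := by
  rw [criticalCurveContinuity_iff_window_gives_constancy_and_hexSAW]
  exact forall_congr' fun _ => ⟨fun h => h.2, fun h => ⟨h1, h⟩⟩

/-! ### The residual content read on the lattice: the window meets the corner (wave-1 worker audit) -/

/-- Under the window's SLE_{8/3} statement (the third clause of `MassiveWindowSLE` for witnesses
`m, x`), DCS Conjecture 1 is EXACTLY the LATTICE statement "the window laws `𝔓_{x(δ), y_c − m(δ)δ}`
and the critical hexagonal SAW laws `hexSAWLaw` are asymptotically equal on bounded continuous test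
functions" (uniqueness in law of chordal SLE one way, `Tendsto.sub` the other). -/
theorem hexSAW_iff_windowMeetsCorner : ∀ {m x : ℝ → ℝ},
    (∀ (D : DobrushinDomain) (a b : ℝ → HexVertex), SAW.IsEmbEndpointApprox hexGraph hexCenter D a b →
      ConvergesInLawToSLE ((8 : ℝ≥0) / 3) D
        (fun δ (γ : SAW.HexDomainSAW D.carrier δ (a δ) (b δ)) => γ.curve)
        (fun δ => tiltLaw D.carrier δ (x δ) ((Real.sqrt 3)⁻¹ - m δ * δ) (a δ) (b δ))) →
    (SAW.HexSAWScalingLimit ↔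
      ∀ (D : DobrushinDomain) (a b : ℝ → HexVertex), SAW.IsEmbEndpointApprox hexGraph hexCenter D a b →
        ∀ f : CurveClass ℂ →ᵇ ℝ,
          Tendsto (fun δ =>
              (∫ γ, f γ.curve ∂(tiltLaw D.carrier δ (x δ) ((Real.sqrt 3)⁻¹ - m δ * δ) (a δ) (b δ))) -
                ∫ γ, f γ.curve ∂(SAW.hexSAWLaw D.carrier δ (a δ) (b δ)))
            (𝓝[>] (0 : ℝ)) (𝓝 0)) := by
  intro m x hW
  constructor
  · intro hHex D a b hab f
    obtain ⟨Γ, hΓ, -, hT⟩ := hW D a b hab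
    obtain ⟨Γ', hΓ', -, hT'⟩ := hHex D a b hab
    have hlaw : Process.preWienerMeasure.map Γ = Process.preWienerMeasure.map Γ' :=
      IsSLECurve.map_eq_holds hΓ hΓ'
    have hint : ∫ ω, f (Γ ω) ∂Process.preWienerMeasure = ∫ ω, f (Γ' ω) ∂Process.preWienerMeasure := by
      rw [← integral_map hΓ.aemeasurable f.continuous.aestronglyMeasurable,
        ← integral_map hΓ'.aemeasurable f.continuous.aestronglyMeasurable, hlaw]
    have := (hT f).sub (hT' f)
    rwa [hint, sub_self] at this
  · intro hWMC D a b hab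
    obtain ⟨Γ, hΓ, -, hT⟩ := hW D a b hab
    refine ⟨Γ, hΓ, Eventually.of_forall fun δ => (SAW.EmbDomainSAW.measurable_of_top _).aemeasurable,
      fun f => ?_⟩
    have := (hT f).sub (hWMC D a b hab f)
    simpa only [sub_sub_cancel, sub_zero] using this

/-- **The corner landing on the lattice.** `MassiveWindowSLE → HexSAWScalingLimit` (the crux modulo
stub 1, = stub 2 for every constancy curve) is EXACTLY: for all window witnesses `m → ∞`,
`m δ · δ → 0` whose window laws converge to SLE_{8/3}, the window laws meet the critical hexagonal
SAW laws asymptotically. This is the precise statement a prover of the promoted stub must supply. -/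
theorem window_gives_hexSAW_iff_windowMeetsCorner :
    (MassiveWindowSLE → SAW.HexSAWScalingLimit) ↔
      ∀ m x : ℝ → ℝ, Tendsto m (𝓝[>] (0 : ℝ)) atTop →
        Tendsto (fun δ => m δ * δ) (𝓝[>] (0 : ℝ)) (𝓝 0) →
        (∀ (D : DobrushinDomain) (a b : ℝ → HexVertex),
          SAW.IsEmbEndpointApprox hexGraph hexCenter D a b →
            ConvergesInLawToSLE ((8 : ℝ≥0) / 3) D
              (fun δ (γ : SAW.HexDomainSAW D.carrier δ (a δ) (b δ)) => γ.curve)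
              (fun δ => tiltLaw D.carrier δ (x δ) ((Real.sqrt 3)⁻¹ - m δ * δ) (a δ) (b δ))) →
        ∀ (D : DobrushinDomain) (a b : ℝ → HexVertex),
          SAW.IsEmbEndpointApprox hexGraph hexCenter D a b →
            ∀ f : CurveClass ℂ →ᵇ ℝ,
              Tendsto (fun δ =>
                  (∫ γ, f γ.curve ∂(tiltLaw D.carrier δ (x δ) ((Real.sqrt 3)⁻¹ - m δ * δ) (a δ) (b δ))) -
                    ∫ γ, f γ.curve ∂(SAW.hexSAWLaw D.carrier δ (a δ) (b δ)))
                (𝓝[>] (0 : ℝ)) (𝓝 0) := by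
  rw [massiveWindowSLE_iff]
  constructor
  · intro h m x hm hmd hW
    exact (hexSAW_iff_windowMeetsCorner hW).1 (h ⟨m, x, hm, hmd, hW⟩)
  · rintro h ⟨m, x, hm, hmd, hW⟩
    exact (hexSAW_iff_windowMeetsCorner hW).2 (h m x hm hmd hW)

end Summit.CriticalPhenomena.SAWScalingLimit.Theorems.SAWMassiveIsingTilt

end
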